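import Literature.NumberTheory.PAdicHodge.KummerFilZeroCoboundarySupersingular
import Literature.NumberTheory.PAdicHodge.UnramifiedWittVectors
import HarnessLib

/-!
# Brick K1, the UNRAMIFIED SUPPLY of `Γ_F`-fixed lifts: the constant points `P_x ∈ Ŵ(𝔫)` with parameter `p·x`, `x ∈ W(k̄)^{Γ_F}`,
# and the Kummer-coboundary capstone for base points rational over the unramified subfield

Topic `Literature/NumberTheory/PAdicHodge`; namespace `Literature.NumberTheory.PAdicHodge.AinfTop`. Companion of
`AinfWeierstrassKummerIntegral.lean` §4 (the supply `zpPt c`, `c ∈ ℤ_p`) — here `ℤ_p` is replaced by Fontaine's subring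
`W(k̄) ⊆ 𝔸_inf(F)` (`wittToAinf`, file `UnramifiedWittVectors`): for `x ∈ W(k̄)` the point `wittPt x ∈ Ŵ(𝔫)` with parameter
`p·x` (`θ(p·x) = p·x ∈ p𝒪_{ℂ_F}`, so `p·x ∈ 𝔫 = θ⁻¹(𝔪)`); it is fixed by every `σ ∈ Γ_F` fixing `x` (`𝕎(σ̄) x = x`,
`galAinf_wittToAinf`) — in particular by all of `Γ_F` when `x ∈ W(k_F) = 𝒪_{F₀}`, `F₀ ⊆ F` the maximal unramified subfield.
Hence the integrating elements and the Kummer-coboundary theorems of `AinfWeierstrassKummerIntegral(Eta).lean` /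
`KummerFilZeroCoboundarySupersingular.lean` for `[p]`-division sequences `u` of `Ŵ(𝔪_{ℂ_F})` whose base point `u₀` has
parameter `θ(p·x)`:

* `of_wittToAinf_mul_mem_nilTheta`, `wittPt`, `coe_val_wittPt`, `galPtN_wittPt`, `coe_theta_val_wittPt`;
* `exists_gal_sub_eq_omegaPeriod_of_witt`, `exists_integratingPair_of_witt` — `b_ω ∈ Fil¹`, `b_η ∈ B_dR⁺` with
  `(σ − 1) b = ∫_{κ_u σ}`;
* `isFilZeroCoboundary_kummerCocycle_curveF_of_witt` (modulo (HT), (Nη)) and the UNCONDITIONAL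
  `isFilZeroCoboundary_kummerCocycle_curveF_of_witt_of_five_le` (`p ≥ 5`, good supersingular reduction): the Kummer cocycle
  `κ_u` dies in `H¹(F, B_dR⁺ ⊗ V_pE)`.
One definition (`wittPt`), no named fact, no `sorry`, no instance. BSD / K★ are not proved by any of this.

References: [FontaineAsterisque223III] Exp. II §1.2, §1.5; [BlochKato1990] Ex. 3.10.1, (3.11.1), Lemma 3.8.1;
[Kato1993LNM1553] Ch. II Lemma 1.4.3; [Tate1967] §4; [SerreLocalFields1979] Ch. II §5.
-/

noncomputable section

open WittVector IsLocalRing Field ValuativeRel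
open scoped ValuativeRel TensorProduct

namespace Literature.NumberTheory.PAdicHodge

open Literature Literature.NumberTheory.GaloisRepresentations Literature.NumberTheory.EllipticCurves WeierstrassCurve
open Literature.NumberTheory.GaloisRepresentations.IsNonarchimedeanLocalField

namespace AinfTop

variable {F : Type} [Field F] [ValuativeRel F] [TopologicalSpace F] [IsNonarchimedeanLocalField F] [CharZero F]
  {p : ℕ} [Fact p.Prime] [Fact (¬ IsUnit (p : maxUnramifiedCompletion F))]
  [CharP (ResidueField (maxUnramifiedCompletion F)) p] [Fact (¬ IsUnit (p : integerC F))]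
  [IsAdicComplete (Ideal.span {(p : integerC F)}) (integerC F)]
  {hθ : Function.Surjective (fontaineTheta (integerC F) p)} (W : WeierstrassCurve ℤ)

/-- `p·x ∈ 𝔫` for `x ∈ W(k̄) ⊆ 𝔸_inf` (`p ∈ (p, ξ) ⊆ 𝔫`). [cite: FontaineAsterisque223III, Exp. II §1.2.2] -/
theorem of_wittToAinf_mul_mem_nilTheta (x : WittVector p (ResidueField (maxUnramifiedCompletion F))) :
    of F p (wittToAinf F p ((p : WittVector p (ResidueField (maxUnramifiedCompletion F))) * x)) ∈ (nilTheta F p hθ).toIdeal := by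
  rw [map_mul, map_mul, map_natCast, map_natCast]
  refine Ideal.mul_mem_right _ _ (ideal_le_nilTheta ?_)
  rw [ideal_eq]
  exact Ideal.subset_span (by simp)

/-- **The constant point `P_x ∈ Ŵ(𝔫)` with parameter `p·x`, `x ∈ W(k̄)`** — a lift of the point of `Ŵ(p𝒪̂_{F^nr})` with
parameter `p·x`. [cite: FontaineAsterisque223III, Exp. II §1.2.2] -/
def wittPt (hθ : Function.Surjective (fontaineTheta (integerC F) p)) (x : WittVector p (ResidueField (maxUnramifiedCompletion F))) :
    W.Pt (nilTheta F p hθ) :=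
  ⟨⟨of F p (wittToAinf F p ((p : WittVector p (ResidueField (maxUnramifiedCompletion F))) * x)), of_wittToAinf_mul_mem_nilTheta x⟩⟩

/-- Unfolding `wittPt`. [cite: FontaineAsterisque223III, Exp. II §1.2.2] -/
@[simp] theorem coe_val_wittPt (x : WittVector p (ResidueField (maxUnramifiedCompletion F))) :
    ((wittPt W hθ x).val : AinfTop F p) = of F p (wittToAinf F p ((p : WittVector p (ResidueField (maxUnramifiedCompletion F))) * x)) :=
  rfl

set_option maxHeartbeats 400000 in
/-- **`σ` fixes `P_x` whenever `σ̄` fixes `x`** (`σ(ι x) = ι(𝕎(σ̄) x)`, `galAinf_wittToAinf`); in particular all of `Γ_F` fixes `P_x`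
for `x ∈ W(k_F)`. [cite: FontaineAsterisque223III, Exp. II §1.2] -/
theorem galPtN_wittPt (σ : absoluteGaloisGroup F) (x : WittVector p (ResidueField (maxUnramifiedCompletion F)))
    (hx : WittVector.map (residueGal σ) x = x) : galPtN W hθ σ (wittPt W hθ x) = wittPt W hθ x :=
  WeierstrassCurve.Pt.ext (Subtype.ext (by
    rw [coe_val_galPtN, coe_val_wittPt, gal_of, galAinf_wittToAinf, map_mul, map_natCast, hx]))

/-- **`θ(P_x) = p·x` in `ℂ_F`** (`θ ∘ ι = ` the embedding `W(k̄) ⊆ 𝒪̂_{F^nr} ⊆ 𝒪_{ℂ_F}`).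
[cite: FontaineAsterisque223III, Exp. II §1.2.2] -/
theorem coe_theta_val_wittPt [IsAdicComplete (Ideal.span {(p : maxUnramifiedCompletion F)}) (maxUnramifiedCompletion F)]
    (x : WittVector p (ResidueField (maxUnramifiedCompletion F))) :
    ((theta F p (wittPt W hθ x).val : CBall F) : CompletedAlgClosure F) =
      (p : CompletedAlgClosure F) * maxUnramifiedCompletion.toC F (wittToCompletion F p x) := by
  rw [coe_val_wittPt, coe_theta, map_mul, map_natCast, map_mul, map_natCast, ← coe_fontaineTheta_wittToAinf]
  push_cast
  rfl

/-- **Brick K1, floor 3 (ω), for base points rational over the unramified subfield**: a `[p]`-division sequence `u` in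
`Ŵ(𝔪_{ℂ_F})` whose base point has parameter `θ(p·x)`, `x ∈ W(k̄)` fixed by `Γ_F`, has an ω-integrating element
`b ∈ Fil¹B_dR⁺(F)`: `σ b − b = ∫_{κ_u(σ)} ω`. [cite: BlochKato1990, Ex. 3.10.1, (3.11.1)] [cite: Kato1993LNM1553, Ch. II Lemma 1.4.3] -/
theorem exists_gal_sub_eq_omegaPeriod_of_witt {u : ℕ → (maxNilIdealC F).toIdeal} (hup : ∀ n, mulPC F p W (u (n + 1)) = u n)
    (x : WittVector p (ResidueField (maxUnramifiedCompletion F))) (hx : ∀ σ : absoluteGaloisGroup F, WittVector.map (residueGal σ) x = x)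
    (hu0 : (u 0 : CBall F) = theta F p (of F p (wittToAinf F p ((p : WittVector p (ResidueField (maxUnramifiedCompletion F))) * x)))) :
    ∃ hu₀ : ∀ σ : absoluteGaloisGroup F, galCBall σ (u 0 : CBall F) = u 0,
      ∃ b : BdRPlusTop F p, b ∈ (BdRPlusTop.filOne F p).toIdeal ∧ ∀ σ : absoluteGaloisGroup F,
        BdRPlusTop.gal F p σ b - b = omegaPeriodHom W hθ (kummerCocycle W u hup hu₀ σ) := by
  have hQ : thetaPt W hθ (wittPt W hθ x) = ⟨u 0⟩ :=
    WeierstrassCurve.Pt.ext (Subtype.ext (by rw [coe_val_thetaPt, coe_val_wittPt, hu0]))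
  exact ⟨galCBall_base_eq_of_fixedLift W hQ fun σ => galPtN_wittPt W σ x (hx σ),
    exists_gal_sub_eq_omegaPeriodHom_kummerCocycle W hup hQ fun σ => galPtN_wittPt W σ x (hx σ)⟩

/-- **Brick K1, floors 3 (ω, η) for base points rational over the unramified subfield**: an integrating PAIR `b_ω ∈ Fil¹`,
`b_η ∈ B_dR⁺` with `(σ − 1) b_ω = ∫_{κ_u σ} ω`, `(σ − 1) b_η = ∫_{κ_u σ} η`.
[cite: BlochKato1990, Ex. 3.10.1, (3.11.1)] [cite: Kato1993LNM1553, Ch. II Lemma 1.4.3] -/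
theorem exists_integratingPair_of_witt {u : ℕ → (maxNilIdealC F).toIdeal} (hup : ∀ n, mulPC F p W (u (n + 1)) = u n)
    (x : WittVector p (ResidueField (maxUnramifiedCompletion F))) (hx : ∀ σ : absoluteGaloisGroup F, WittVector.map (residueGal σ) x = x)
    (hu0 : (u 0 : CBall F) = theta F p (of F p (wittToAinf F p ((p : WittVector p (ResidueField (maxUnramifiedCompletion F))) * x)))) :
    ∃ hu₀ : ∀ σ : absoluteGaloisGroup F, galCBall σ (u 0 : CBall F) = u 0,
      ∃ bω bη : BdRPlusTop F p, bω ∈ (BdRPlusTop.filOne F p).toIdeal ∧ ∀ σ : absoluteGaloisGroup F,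
        BdRPlusTop.gal F p σ bω - bω = omegaPeriodHom W hθ (kummerCocycle W u hup hu₀ σ) ∧
          BdRPlusTop.gal F p σ bη - bη = etaPeriodHom W hθ (kummerCocycle W u hup hu₀ σ) := by
  have hQ : thetaPt W hθ (wittPt W hθ x) = ⟨u 0⟩ :=
    WeierstrassCurve.Pt.ext (Subtype.ext (by rw [coe_val_thetaPt, coe_val_wittPt, hu0]))
  exact ⟨galCBall_base_eq_of_fixedLift W hQ fun σ => galPtN_wittPt W σ x (hx σ),
    exists_integratingPair_kummerCocycle W hup hQ fun σ => galPtN_wittPt W σ x (hx σ)⟩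

end AinfTop

variable {F : Type} [Field F] [ValuativeRel F] [TopologicalSpace F] [IsNonarchimedeanLocalField F] [CharZero F]
  {p : ℕ} [Fact p.Prime] [Fact (¬ IsUnit (p : maxUnramifiedCompletion F))]
  [CharP (ResidueField (maxUnramifiedCompletion F)) p] [Fact (¬ IsUnit (p : integerC F))]
  [IsAdicComplete (Ideal.span {(p : integerC F)}) (integerC F)] (hp : valuation F p < 1) [Algebra ℚ_[p] F]

/-- **Base points rational over the unramified subfield** (parameter `θ(p·x)`, `x ∈ W(k̄)^{Γ_F}`): the Kummer cocycle of a
`[p]`-division sequence dies in `H¹(F, B_dR⁺ ⊗ V_pE)` (good supersingular reduction, modulo (HT), (Nη)).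
[cite: BlochKato1990, Ex. 3.10.1, (3.11.1)] [cite: Kato1993LNM1553, Ch. II Lemma 1.4.3] -/
theorem isFilZeroCoboundary_kummerCocycle_curveF_of_witt (W : WeierstrassCurve ℤ) [(AinfTop.curveF F W).IsElliptic]
    (hp2 : p ≠ 2) (hΔ : ¬ (p : ℤ) ∣ W.Δ) (hA : (W.map (Int.castRingHom (ZMod p))).hasseCoeff p = 0)
    (hHT : ∃ τ : AinfTop.TatePt F p W, AinfTop.omegaPeriodHom W (surjective_fontaineTheta_integerC hp) τ ∉
      ((BdRPlusTop.filOne F p).toIdeal ^ 2 : Ideal (BdRPlusTop F p)))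
    (hNη : ∃ τ : AinfTop.TatePt F p W, AinfTop.mulDefectC W p (AinfTop.seq W τ 1) ∉ Ideal.span {(p : CBall F)})
    {u : ℕ → (maxNilIdealC F).toIdeal} (hup : ∀ n, AinfTop.mulPC F p W (u (n + 1)) = u n)
    (x : WittVector p (ResidueField (maxUnramifiedCompletion F))) (hx : ∀ σ : absoluteGaloisGroup F, WittVector.map (residueGal σ) x = x)
    (hu0 : (u 0 : CBall F) =
      AinfTop.theta F p (AinfTop.of F p (wittToAinf F p ((p : WittVector p (ResidueField (maxUnramifiedCompletion F))) * x)))) :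
    ∃ hu₀ : ∀ σ : absoluteGaloisGroup F, galCBall σ (u 0 : CBall F) = u 0,
      (bdRPeriodRingData (F := F) (p := p) hp).IsFilZeroCoboundary (rationalTateRep (AinfTop.curveF F W) p) fun σ =>
        ((1 : (bdRPeriodRingData (F := F) (p := p) hp).B) ⊗ₜ[ℚ_[p]]
          TateModule.toRational p ((AinfTop.tateGeomEquivTatePtSS F W p norm_natCast_C_lt_one' hp2 hΔ hA).symm
            (AinfTop.kummerCocycle W u hup hu₀ σ)) :
          (bdRPeriodRingData (F := F) (p := p) hp).B ⊗[ℚ_[p]] (AinfTop.curveF F W).rationalTateModule p) := by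
  have hQ : AinfTop.thetaPt W (surjective_fontaineTheta_integerC hp) (AinfTop.wittPt W (surjective_fontaineTheta_integerC hp) x) =
      ⟨u 0⟩ :=
    WeierstrassCurve.Pt.ext (Subtype.ext (by rw [AinfTop.coe_val_thetaPt, AinfTop.coe_val_wittPt, hu0]))
  exact ⟨AinfTop.galCBall_base_eq_of_fixedLift W hQ fun σ => AinfTop.galPtN_wittPt W σ x (hx σ),
    isFilZeroCoboundary_kummerCocycle_curveF hp W hp2 hΔ hA hHT hNη hup hQ fun σ => AinfTop.galPtN_wittPt W σ x (hx σ)⟩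

/-- **UNCONDITIONAL, base points rational over the unramified subfield** (`p ≥ 5`, good supersingular reduction): the Kummer
cocycle of a `[p]`-division sequence of the point with parameter `θ(p·x)`, `x ∈ W(k̄)^{Γ_F}`, dies in `H¹(F, B_dR⁺ ⊗ V_pE)`.
[cite: BlochKato1990, Ex. 3.10.1, (3.11.1), Lemma 3.8.1] [cite: Tate1967, §4] -/
theorem isFilZeroCoboundary_kummerCocycle_curveF_of_witt_of_five_le (W : WeierstrassCurve ℤ) [(AinfTop.curveF F W).IsElliptic]
    (hp5 : 5 ≤ p) (hΔ : ¬ (p : ℤ) ∣ W.Δ) (hA : (W.map (Int.castRingHom (ZMod p))).hasseCoeff p = 0)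
    {u : ℕ → (maxNilIdealC F).toIdeal} (hup : ∀ n, AinfTop.mulPC F p W (u (n + 1)) = u n)
    (x : WittVector p (ResidueField (maxUnramifiedCompletion F))) (hx : ∀ σ : absoluteGaloisGroup F, WittVector.map (residueGal σ) x = x)
    (hu0 : (u 0 : CBall F) =
      AinfTop.theta F p (AinfTop.of F p (wittToAinf F p ((p : WittVector p (ResidueField (maxUnramifiedCompletion F))) * x)))) :
    ∃ hu₀ : ∀ σ : absoluteGaloisGroup F, galCBall σ (u 0 : CBall F) = u 0,
      (bdRPeriodRingData (F := F) (p := p) hp).IsFilZeroCoboundary (rationalTateRep (AinfTop.curveF F W) p) fun σ =>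
        ((1 : (bdRPeriodRingData (F := F) (p := p) hp).B) ⊗ₜ[ℚ_[p]]
          TateModule.toRational p ((AinfTop.tateGeomEquivTatePtSS F W p norm_natCast_C_lt_one' (by omega) hΔ hA).symm
            (AinfTop.kummerCocycle W u hup hu₀ σ)) :
          (bdRPeriodRingData (F := F) (p := p) hp).B ⊗[ℚ_[p]] (AinfTop.curveF F W).rationalTateModule p) :=
  isFilZeroCoboundary_kummerCocycle_curveF_of_witt hp W (by omega) hΔ hA
    (AinfTop.exists_omegaPeriodHom_not_mem_filOne_sq W hp5 hΔ hA) (AinfTop.exists_tatePt_mulDefectC_not_mem W (by omega) hΔ hA)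
    hup x hx hu0

end Literature.NumberTheory.PAdicHodge

end
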